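import Literature.IUT.HodgeArakelov.BadPrimeGaussianMonoidsCohomologyModelProofs2
import Literature.IUT.HodgeArakelov.LabelClassesOfCusps

/-!
# [IUTchII] Cor 3.5 (i)/(ii): the AUGMENTATION DATUM of `…CohomologyModelProofs2` supplied by Definition 2.3 (i)'s
# tower `Π_v ⊆ Π^±_v ⊆ Π̂^cor_v ↠ G_v` — symmetrizing elements `γ_t ∈ Δ̂^cor_v` give sections agreeing modulo `Δ`
# (proof-only; junction of abc-iut-L6-t1's `PlusMinusTower` with abc-iut-L6-t1's `AbsTopMonoids.Delta`)

S. Mochizuki, *Inter-universal Teichmüller theory II*, kurims Dec-2020 manuscript: Def 2.3 (i) p. 67 ("we shall use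
these diagrams to regard the various groups … as subgroups, well-defined up to `Π̂^cor_v`-conjugacy, of `Π̂^cor_v`";
"`Δ̂^cor_v/Δ̂^±_v ≅ Π̂^cor_v/Π̂^±_v ≅ 𝔽_l^{⋊±}`"), Cor 2.4 (iii) p. 70 ("compatible with conjugation by arbitrary
`δ ∈ Π̂^cor_v` … `𝔽_l^{⋊±}`-symmetry"), Cor 3.5 (i) p. 94 ("the `Δ_X(M^Θ_*)`-outer action of
`𝔽_l^{⋊±} ≅ Δ_C(M^Θ_*)/Δ_X(M^Θ_*)` on `Π_X(M^Θ_*)` … induces isomorphisms … [`𝔽_l^{⋊±}`-]symmetrizing isomorphisms";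
"this inner automorphism indeterminacy … is, in fact, independent of `|t|`") [cite: Mochizuki2012, Cor 3.5 (i) p.94].
Claim key DISPUTED (D-0012). PROOF-ONLY companion (abc-iut cell, layer L6, seat abc-iut-w4-d004 gen 2; node
**IUTchII:Cor3.5(ii)** Galois clause, sub-DAG rows Cor-35.i.r4 / Cor-35.ii.r10). NO definition, NO `Prop` fact.

`…CohomologyModelProofs2.sections_mk_eq_of_aug` derived the hypothesis `hs` ("the sections `s_t : G_v → Π_X(M^Θ_*)`
agree modulo `Δ`") from an AUGMENTATION DATUM: a homomorphism `a : Π → G_v` on the ambient group with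
`Ker(a ∘ j) ≤ Δ` killing the symmetrizing elements `γ_t`. THIS FILE supplies that datum from the landed typing of
Def 2.3 (i) (abc-iut-L6-t1 `PlusMinusTower`: the ambient `Π̂^cor_v = W.Corhat` with its augmentation
`W.aug : Π̂^cor_v ↠ G_v`, the embedding `Π_v ↪ Π^±_v ↪ Π̂^cor_v` = `W.emb ∘ T.incl`, and `aug_compat`) and the
group-theoreticity of `Δ` (abc-iut-L6-t1 `AbsTopMonoids.Delta_map` / `Delta_base`: `Δ` is carried to
`Δ_X = Ker(Π^tp_{X̲̲_v} ↠ G_v)` by EVERY isomorphism with the reference group):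
* `AbsTopMonoids.mem_Delta_iff_aug_eq_one` — for any isomorph `Π` and ANY identification `e : Π ≅ Π^tp_{X̲̲_v}`:
  `x ∈ Δ ↔ aug (e x) = 1`;
* `PlusMinusTower.aug_emb_eq_one_iff` — inside `Π̂^cor_v`: `W.aug (x) = 1 ↔ x ∈ Δ` for `x ∈ Π_v`, i.e.
  `Ker(W.aug ∘ W.emb ∘ T.incl) = Δ` (`Δ_v = Π_v ∩ Δ̂^cor_v`);
* `sections_mk_eq_of_plusMinusTower` — sections of the form `γ_t ι(−) γ_t⁻¹` (in `Π̂^cor_v`) with `γ_t ∈ Δ̂^cor_v`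
  (the lifts of `𝔽_l^{⋊±} ≅ Δ̂^cor_v/Δ̂^±_v`) AGREE MODULO `Δ` — the hypothesis `hs` of the whole Cor 3.5 (ii) family
  (`SyncProofs` … `CohomologyModelProofs2`) DISCHARGED by the Def 2.3 (i) tower;
* `mrange_pi_diagonalStable'_ofCohomologyModel_of_plusMinusTower` — the Galois clause at the cohomology model over
  the ambient group `Π̂^cor_v` (`j := W.emb ∘ T.incl`, `a := W.aug`), residual = Kummer datum + model identification
  `ψ` + presentation of the sections by `γ_t ∈ Δ̂^cor_v` and one evaluation section `ι` landing in `Π_Ÿ` + `θ` top-level.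

Nothing here asserts a disputed claim or takes a side on [IUTchIII] Cor 3.12; typed ≠ proved ≠ endorsed.
-/

namespace Literature.IUT.HodgeArakelov

open Literature.AnabelianGeometry.EtaleTheta CohomologySystemOfContH1 TemperedThetaMonoids

universe u v

/-! ### 1. `Δ` of an isomorph is the kernel of the reference augmentation along ANY identification -/

section Delta

variable {S : ThetaSetting.{u}} (A : AbsTopMonoids S) (Pc : IsoClass S.PiX)

/-- **`Δ` is group-theoretic** ([AbsAnab] Lem 1.3.8 as typed by abc-iut-L6-t1's `AbsTopMonoids.Delta_map` /
`Delta_base`): for an isomorph `Π` of `Π^tp_{X̲̲_v}` and ANY isomorphism of topological groups `f : Π ≅ Π^tp_{X̲̲_v}`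
(a morphism to the reference object of `IsoClass`), `x ∈ Δ ↔ aug (f x) = 1` (`Δ_X = Ker(Π^tp_{X̲̲_v} ↠ G_v)`). [cite: Mochizuki2012, Ex 1.8 (ii) p.36] -/
theorem AbsTopMonoids.mem_Delta_iff_aug_eq_one (f : Pc ⟶ IsoClass.base S.PiX) (x : Pc.G) :
    x ∈ A.Delta Pc ↔ S.aug (IsoClass.homIso f x) = 1 := by
  have h := A.Delta_map f
  rw [A.Delta_base] at h
  constructor
  · intro hx
    have hmem := Subgroup.mem_map_of_mem (IsoClass.homIso f).toMulEquiv.toMonoidHom hx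
    rw [h] at hmem
    exact MonoidHom.mem_ker.mp hmem
  · intro hx
    have hmem : IsoClass.homIso f x ∈ S.DeltaX := MonoidHom.mem_ker.mpr hx
    rw [← h] at hmem
    obtain ⟨y, hy, hyx⟩ := Subgroup.mem_map.mp hmem
    have hyx' : y = x := (IsoClass.homIso f).injective hyx
    exact hyx' ▸ hy

end Delta

/-! ### 2. Inside `Π̂^cor_v`: `Ker(Π_v → Π̂^cor_v ↠ G_v) = Δ` -/

section Tower

variable {S : BadPlaceSetting.{u}} (A : AbsTopMonoids S.toThetaSetting) {Pv : TopGroup.{u}}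
  {T : TemperedCoverings S Pv} (W : PlusMinusTower T)

/-- **IUTchII:Def2.3(i)** (kurims p.67) junction: an element of `Π_v` dies under the augmentation
`Π̂^cor_v ↠ G_v` of the tower iff it lies in `Δ` (`Δ_v = Π_v ∩ Δ̂^cor_v`) — from `PlusMinusTower.aug_compat`
("compatibility of the augmentation with `Π_v ≅ Π_X(·) ↠ G` through some reference identification") and
`AbsTopMonoids.mem_Delta_iff_aug_eq_one`. [cite: Mochizuki2012, Def 2.3 (i) p.67] -/
theorem PlusMinusTower.aug_emb_eq_one_iff (x : Pv) :
    W.aug (W.emb (T.incl x)) = 1 ↔ x ∈ A.Delta ⟨Pv, T.isoRef⟩ := by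
  obtain ⟨e, he⟩ := W.aug_compat
  rw [he]
  exact (AbsTopMonoids.mem_Delta_iff_aug_eq_one A ⟨Pv, T.isoRef⟩ e x).symm

/-- **IUTchII:Cor3.5(i)** (kurims p.94 "this inner automorphism indeterminacy … is, in fact, independent of `|t|`"):
sections `s_t : Π₀ → Π_v` which, inside `Π̂^cor_v`, are conjugates `γ_t ι(−) γ_t⁻¹` of one evaluation section
`ι : Π₀ → Π̂^cor_v` by elements `γ_t ∈ Δ̂^cor_v = Ker(Π̂^cor_v ↠ G_v)` (lifts of the `𝔽_l^{⋊±}`-symmetries,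
Def 2.3 (i) / Cor 2.4 (iii)) AGREE MODULO `Δ` — the hypothesis `hs` of the Cor 3.5 (ii) family DISCHARGED by the
tower. [cite: Mochizuki2012, Cor 3.5 (i) p.94] -/
theorem sections_mk_eq_of_plusMinusTower {P₀ : TopGroup.{u}} (ι : P₀ →* W.Corhat) {L : Type*}
    (γ : L → W.Corhat) (hγ : ∀ t, γ t ∈ W.aug.ker) (s : L → (P₀ →* Pv))
    (hjs : ∀ t g, W.emb (T.incl (s t g)) = γ t * ι g * (γ t)⁻¹) (t t' : L) (g : P₀) :
    (QuotientGroup.mk (s t g) : Pv ⧸ A.Delta ⟨Pv, T.isoRef⟩) = QuotientGroup.mk (s t' g) :=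
  @BadPrimeGaussianMonoids.sections_mk_eq_of_aug _ _ _ _ ι (W.emb.comp T.incl) _ γ s _ _ W.aug
    (A.Delta ⟨Pv, T.isoRef⟩) (A.Delta_normal _) (fun x hx => (W.aug_emb_eq_one_iff A x).mp hx)
    (fun t => MonoidHom.mem_ker.mp (hγ t)) (fun t g => hjs t g) t t' g

end Tower

/-! ### 3. The Galois clause over the ambient group `Π̂^cor_v` -/

namespace BadPrimeGaussianMonoids

section Assembly

variable {S : BadPlaceSetting.{u}} (A : AbsTopMonoids S.toThetaSetting) {Pv : TopGroup.{u}}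
  {T : TemperedCoverings S Pv} (W : PlusMinusTower T)
  (E : TemperedThetaMonoids.ThetaEnvData.{u, v} Pv) (κ : A.MTM ⟨Pv, T.isoRef⟩ →* E.H) {L : Type*}
  {P₀ : TopGroup.{u}} {G' : Type u} [Group G'] [TopologicalSpace G'] [IsTopologicalGroup G']
  (φ : W.Corhat →* G') (Am : Subgroup G') [Am.Normal] [IsMulCommutative Am] (N : Subgroup W.Corhat) [N.Normal]
  (ι : P₀ →* W.Corhat) (hι : Continuous ι) (hH : (⊤ : Subgroup P₀).map ι ≤ N)
  (ψ : Additive E.H ≃+ h1Lim φ Am N ⊥) (γ : L → W.Corhat) (s : L → (P₀ →* Pv))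

/-- **IUTchII:Cor3.5(ii)** (kurims p.95) "each `Ψ_ξ(M^Θ_*)` is equipped with a natural action by
`G_v(M^Θ_*▶)_{⟨F_l^⋇⟩}`", restrictions out of the theta monoid, at the cohomology model OVER THE AMBIENT GROUP
`Π̂^cor_v` of Def 2.3 (i) (`j := Π_v ↪ Π^±_v ↪ Π̂^cor_v`, augmentation `W.aug`): from the Kummer data of Prop 3.1 (ii)
(G-w4d019-1), the model identification `ψ` (equivariant along `j`), the symmetrizing elements `γ_t ∈ Δ̂^cor_v` and one
evaluation section `ι : Π₀ ≅ G_v → Π̂^cor_v` landing in `Π_Ÿ` presenting the sections (`j ∘ s_t = γ_t ι γ_t⁻¹`,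
Cor 2.4 (ii)(c)/(iii)), `θ` top-level, restrictions pinned to `ι^* ∘ conj(γ_t⁻¹) ∘ ψ`. The hypotheses `hs`, `hr`,
`hfix`, `hsync`, `hstab` of the family are all DERIVED. [cite: Mochizuki2012, Cor 3.5 (ii) p.95] -/
theorem mrange_pi_diagonalStable'_ofCohomologyModel_of_plusMinusTower (hκ : Function.Injective κ)
    (hcns : E.constantMonoid = MonoidHom.mrange κ)
    (hκeq : ∀ (x : Pv) (m : A.MTM ⟨Pv, T.isoRef⟩), κ (A.actMTM ⟨Pv, T.isoRef⟩ x m) = E.conj x (κ m))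
    (hγ : ∀ t, γ t ∈ W.aug.ker)
    (hψ : ∀ (p : Pv) (y : E.H),
      ψ (Additive.ofMul (E.conj p y)) = h1LimConj φ Am N (W.emb (T.incl p)) (ψ (Additive.ofMul y)))
    (hjs : ∀ t g, W.emb (T.incl (s t g)) = γ t * ι g * (γ t)⁻¹) (θ : E.H)
    (hθ : ψ (Additive.ofMul θ) ∈ Set.range ((cohomologySystemOfContH1 φ Am N).toLim ⊤))
    (R : L → (E.H →* Multiplicative (h1Lim (φ.comp ι) Am (⊤ : Subgroup P₀) ⊥)))
    (hR : ∀ t y, Multiplicative.toAdd (R t y) =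
      h1LimComap φ Am ι hι hH (h1LimConj φ Am N (γ t)⁻¹ (ψ (Additive.ofMul y)))) (t₀ : L) (g : P₀) :
    (MonoidHom.mrange (MonoidHom.pi fun t =>
        (R t).comp (splitMonoid E.units (Submonoid.powers θ)).subtype)).map
        (piIso L (h1LimConjMulAut (φ.comp ι) Am ⊤ g)).toMonoidHom =
      MonoidHom.mrange (MonoidHom.pi fun t => (R t).comp (splitMonoid E.units (Submonoid.powers θ)).subtype) :=
  mrange_pi_diagonalStable'_ofCohomologyModel_of_aug A ⟨Pv, T.isoRef⟩ E κ φ Am N ι hι hH (W.emb.comp T.incl) ψ γ s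
    hκ hcns hκeq W.aug (fun x hx => (W.aug_emb_eq_one_iff A x).mp hx) (fun t => MonoidHom.mem_ker.mp (hγ t))
    (fun p y => hψ p y) (fun t g => hjs t g) θ hθ R hR t₀ g

end Assembly

end BadPrimeGaussianMonoids

end Literature.IUT.HodgeArakelov
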